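import Literature.Analysis.Convexity.SLemma
import Literature.Algebra.Polynomial.NonnegQuadraticSumOfSquares
import Literature.Algebra.Polynomial.LasserreHierarchy
import HarnessLib

/-!
# One quadratic constraint: the degree-2 SOS certificate (Lasserre's first relaxation) is exact
# (S-lemma, Pólik–Terlaky 2007 Thm 2.2 / §1 (1.1)–(1.3), with Laurent 2008 Lemma 3.6 and (6.2))

Topic `Literature/Algebra/Polynomial`, the SOS / Lasserre series next to `LasserreHierarchy.lean`,
`NonnegQuadraticSumOfSquares.lean` and `ConvexQuadraticSosExact.lean` (Laurent's Lemma 3.10: order 1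
is exact for CONVEX quadratic programs, from KKT multipliers).  This file records the other
classical exact case, with no convexity and no compactness: ONE quadratic inequality constraint
with a Slater point.  It is the polynomial-optimization reading of the tree's S-lemma
(`Literature.Analysis.Convexity.SLemma`, Pólik–Terlaky Theorem 2.2, proved there from Dines'
theorem and Yuan's lemma); nothing here is new mathematics — the file only composes cited results
in the tree's `MvPolynomial` / `truncQuadraticModule` / `sosFeasible` vocabulary.

Sources, quoted VERBATIM from the held texts.

I. Pólik, T. Terlaky, *A survey of the S-lemma*, SIAM Review 49 (2007) 371–418
[`PolikTerlaky2007`; held text `paper:doi-10-1137-s003614450444614x`].  Theorem 2.2 (p. 376):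
«Let `f, g : ℝⁿ → ℝ` be quadratic functions and suppose that there is an `x̄ ∈ ℝⁿ` such that
`g(x̄) < 0`. Then the following two statements are equivalent. (i) There is no `x ∈ ℝⁿ` such that
`f(x) < 0, g(x) ≤ 0`. (ii) There is a nonnegative number `y ≥ 0` such that `f(x) + y g(x) ≥ 0
∀x ∈ ℝⁿ`.»  §1, (1.1)–(1.3) (pp. 371–372): the S-lemma as exactness of the Lagrangian relaxation
of `min {f(x) : g(x) ≤ 0}` (the tree's `SLemma.lagrangian_exact`).

M. Laurent, *Sums of squares, moment matrices and optimization over polynomials* (2008)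
[`Laurent2008`].  Lemma 3.6 (p. 31 of the held copy): «Any nonnegative quadratic polynomial is a
sum of squares.» (the tree's `NonnegQuadraticSumOfSquares.isSumSq_of_nonneg_of_totalDegree_le_two`);
(6.2) (p. 89): `p^sos_t = sup ρ s.t. p − ρ ∈ M(ḡ)_{2t}` with
`M(ḡ)_{2t} = {s₀ + Σ_j s_j g_j : s_j SOS, deg(s₀), deg(s_j g_j) ≤ 2t}` (the tree's
`PutinarPositivstellensatz.truncQuadraticModule` / `LasserreHierarchy.sosFeasible`); (4.8) (p. 62):
`p^sos ≤ p^mom ≤ p^min`.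

## What is formalised (all proved; no named facts, no definitions besides the example data)

* `exists_quadFunction_eval_eq` — a real polynomial of total degree `≤ 2` is, as a function on
  `ℝ^σ`, a quadratic function `xᵀAx + 2bᵀx + c` in the sense of the tree's `SLemma.QuadFunction`
  (read off from the symmetric Gram matrix in homogeneous coordinates of
  `NonnegQuadraticSumOfSquares.exists_isSymm_eq_gramPoly`).
* **`sLemma_mvPolynomial`** — for `deg p, deg q ≤ 2` with `q(x̄) > 0` somewhere:
  `p ≥ 0` on `{q ≥ 0}` ⟹ `∃ y ≥ 0`, `p − y q ≥ 0` on `ℝ^σ` and `p − y q` is a sum of squares.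
* **`mem_truncQuadraticModule_iff_nonneg`** — `p ∈ M(q; 2) ⟺ p ≥ 0 on K = {q ≥ 0}`; and for the
  program (6.2): **`sub_C_mem_truncQuadraticModule_iff`** (`p − ρ ∈ M(q;2) ⟺ ρ ≤ p on K`),
  `sosFeasible_eq` (the feasible set of (6.2) at order one is `{ρ | ρ ≤ p on K}`), and at an
  attained minimum `sSup_sosFeasible_eq` / `sInf_momentValues_eq`: `p^sos_1 = p^mom_1 = p^min`.
* A NONCONVEX instance, kernel-checked: `p = x₁x₂` on the unit disk `q = 1 − x₁² − x₂² ≥ 0`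
  (indefinite objective, so outside Laurent's Lemma 3.10): `disk_certificate`
  (`x₁x₂ + ½ = ½(x₁ + x₂)² + ½·q`), `disk_min_mem_sosFeasible`, `disk_optimal`, `disk_sSup`
  (`p^sos_1 = p^min = −½`, attained at `(1/√2, −1/√2)`).

Scope (not claimed): two or more constraints (false in general, Pólik–Terlaky §3.3), equality
constraints, and the case without a Slater point (the tree's `SLemma.slater_hypothesis_needed`).
-/

namespace Literature.Algebra.Polynomial.OneQuadraticConstraintSosExact

open MvPolynomial
-- `open Matrix` would resolve to the tree namespace `Literature.Analysis.Matrix` in some import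
-- closures; be explicit.
open _root_.Matrix
open Literature.Analysis.Convexity.SLemma
open Literature.Algebra.Polynomial.NonnegQuadraticSumOfSquares (zh exists_isSymm_eq_gramPoly
  eval_gramPoly_zh isSumSq_of_nonneg_of_totalDegree_le_two)
open Literature.Algebra.Polynomial.PutinarPositivstellensatz (truncQuadraticModule semialgSet)
open Literature.Algebra.Polynomial.LasserreHierarchy

noncomputable section

variable {σ : Type*} [Fintype σ] [DecidableEq σ]

/-! ## §1 Quadratic polynomials as quadratic functions -/

/-- The quadratic function `xᵀAx + 2bᵀx + c` of matrix data, as a `QuadFunction` on `ℝ^σ`.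
[cite: PolikTerlaky2007, §2.2 (2.14) (p. 377)] -/
def quadFunctionOf (A : Matrix σ σ ℝ) (b : σ → ℝ) (c : ℝ) : QuadFunction (σ → ℝ) :=
  ⟨LinearMap.BilinMap.toQuadraticMap (Matrix.toLinearMap₂' ℝ A),
    { toFun := fun x => 2 * b ⬝ᵥ x
      map_add' := fun x y => by simp only [dotProduct_add]; ring
      map_smul' := fun r x => by
        simp only [dotProduct_smul, smul_eq_mul, RingHom.id_apply]; ring }, c⟩

/-- `quadFunctionOf A b c` evaluates to `xᵀAx + 2bᵀx + c`.
[cite: PolikTerlaky2007, §2.2 (2.14) (p. 377)] -/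
theorem quadFunctionOf_eval (A : Matrix σ σ ℝ) (b : σ → ℝ) (c : ℝ) (x : σ → ℝ) :
    (quadFunctionOf A b c).eval x = x ⬝ᵥ A *ᵥ x + 2 * b ⬝ᵥ x + c := by
  simp only [QuadFunction.eval, quadFunctionOf, LinearMap.BilinMap.toQuadraticMap_apply,
    Matrix.toLinearMap₂'_apply', LinearMap.coe_mk, AddHom.coe_mk]

/-- Every real polynomial of total degree `≤ 2` is, as a function, `xᵀAx + 2bᵀx + c` («Let
`p ∈ ℝ[x]₂` of the form `p = xᵀQx + 2cᵀx + b`»), read off from the symmetric Gram matrix `Q̃` of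
`p` in homogeneous coordinates: `A = Q̃|_{x,x}`, `b = Q̃|_{x,1}`, `c = Q̃_{1,1}`.
[cite: Laurent2008, proof of Lemma 3.6 (p. 31)] -/
theorem exists_matrix_eval_eq {p : MvPolynomial σ ℝ} (hp : p.totalDegree ≤ 2) :
    ∃ (A : Matrix σ σ ℝ) (b : σ → ℝ) (c : ℝ),
      ∀ x : σ → ℝ, eval x p = x ⬝ᵥ A *ᵥ x + 2 * b ⬝ᵥ x + c := by
  obtain ⟨Q, hQ, rfl⟩ := exists_isSymm_eq_gramPoly hp
  refine ⟨Q.submatrix some some, fun i => Q (some i) none, Q none none, fun x => ?_⟩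
  rw [eval_gramPoly_zh]
  have hsym : ∀ i, Q none (some i) = Q (some i) none := fun i => hQ.apply (some i) none
  simp only [dotProduct, mulVec, Fintype.sum_option, Option.elim, Matrix.submatrix_apply, hsym,
    one_mul, mul_one]
  have e1 : ∑ i, x i * (Q (some i) none + ∑ j, Q (some i) (some j) * x j) =
      ∑ i, Q (some i) none * x i + ∑ i, x i * ∑ j, Q (some i) (some j) * x j := by
    rw [← Finset.sum_add_distrib]
    exact Finset.sum_congr rfl fun i _ => by ring
  rw [e1]
  ring

/-- Hence every `p ∈ ℝ[x]₂` is the evaluation of a `QuadFunction` (the hypothesis «`f, g` quadratic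
functions» of Theorem 2.2). [cite: PolikTerlaky2007, Theorem 2.2 and (2.14) (pp. 376–377)]
[cite: Laurent2008, proof of Lemma 3.6 (p. 31)] -/
theorem exists_quadFunction_eval_eq {p : MvPolynomial σ ℝ} (hp : p.totalDegree ≤ 2) :
    ∃ f : QuadFunction (σ → ℝ), ∀ x : σ → ℝ, f.eval x = eval x p := by
  obtain ⟨A, b, c, h⟩ := exists_matrix_eval_eq hp
  exact ⟨quadFunctionOf A b c, fun x => by rw [quadFunctionOf_eval, h]⟩

/-! ## §2 The S-lemma for quadratic polynomials, certificate form -/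

/-- **The S-lemma for quadratic polynomials**: if `deg p, deg q ≤ 2`, `q(x̄) > 0` for some `x̄`,
and `p ≥ 0` on `{q ≥ 0}`, then for some `y ≥ 0` the polynomial `p − y q` is nonnegative on the
whole space (Theorem 2.2 in the tree's form `SLemma.sLemma'`), hence a sum of squares of
polynomials (Lemma 3.6): `p = σ + y·q`. [cite: PolikTerlaky2007, Theorem 2.2 (p. 376)]
[cite: Laurent2008, Lemma 3.6 (p. 31)] -/
theorem sLemma_mvPolynomial {p q : MvPolynomial σ ℝ} (hp : p.totalDegree ≤ 2)
    (hq : q.totalDegree ≤ 2) (hS : ∃ xbar : σ → ℝ, 0 < eval xbar q)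
    (h : ∀ x : σ → ℝ, 0 ≤ eval x q → 0 ≤ eval x p) :
    ∃ y : ℝ, 0 ≤ y ∧ (∀ x : σ → ℝ, 0 ≤ eval x p - y * eval x q) ∧ IsSumSq (p - C y * q) := by
  obtain ⟨f, hf⟩ := exists_quadFunction_eval_eq hp
  obtain ⟨g, hg⟩ := exists_quadFunction_eval_eq hq
  obtain ⟨xbar, hxbar⟩ := hS
  obtain ⟨y, hy, hxy⟩ := sLemma' f g ⟨xbar, by rw [hg]; exact hxbar⟩
    (fun x hx => by rw [hf]; exact h x (by rw [← hg]; exact hx))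
  have hfun : ∀ x : σ → ℝ, 0 ≤ eval x p - y * eval x q := fun x => by
    rw [← hf, ← hg]; exact hxy x
  refine ⟨y, hy, hfun, isSumSq_of_nonneg_of_totalDegree_le_two ?_ fun x => ?_⟩
  · refine (totalDegree_sub _ _).trans (max_le hp ?_)
    exact (totalDegree_mul _ _).trans (by rw [totalDegree_C, zero_add]; exact hq)
  · rw [map_sub, map_mul, eval_C]
    exact hfun x

omit [Fintype σ] [DecidableEq σ] in
/-- The basic closed semialgebraic set of the single constraint `q ≥ 0`.
[cite: Laurent2008, (6.2) (p. 89)] -/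
theorem mem_semialgSet_single {q : MvPolynomial σ ℝ} {x : σ → ℝ} :
    x ∈ semialgSet ![q] ↔ 0 ≤ eval x q := by
  simp [semialgSet]

/-- **The degree-2 certificate is complete for one quadratic constraint**: under the hypotheses of
`sLemma_mvPolynomial`, `p ∈ M(q; 2)` — `p = s₀ + s₁ q` with `s₀, s₁` sums of squares and
`deg s₀, deg(s₁ q) ≤ 2` (Laurent's (6.2) at its first order `t = 1`).
[cite: PolikTerlaky2007, Theorem 2.2 (p. 376)] [cite: Laurent2008, (6.2) (p. 89), Lemma 3.6 (p. 31)] -/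
theorem mem_truncQuadraticModule_of_nonneg {p q : MvPolynomial σ ℝ} (hp : p.totalDegree ≤ 2)
    (hq : q.totalDegree ≤ 2) (hS : ∃ xbar : σ → ℝ, 0 < eval xbar q)
    (h : ∀ x : σ → ℝ, 0 ≤ eval x q → 0 ≤ eval x p) : p ∈ truncQuadraticModule ![q] 2 := by
  obtain ⟨y, hy, -, hsos⟩ := sLemma_mvPolynomial hp hq hS h
  have hCy : (C y : MvPolynomial σ ℝ) = C (Real.sqrt y) * C (Real.sqrt y) := by
    rw [← map_mul, Real.mul_self_sqrt hy]
  refine ⟨p - C y * q, ![C y], hsos, fun i => ?_, ?_, fun i => ?_, ?_⟩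
  · obtain rfl : i = 0 := Subsingleton.elim _ _
    rw [Matrix.cons_val_zero, hCy]
    exact IsSumSq.mul_self _
  · refine (totalDegree_sub _ _).trans (max_le hp ?_)
    exact (totalDegree_mul _ _).trans (by rw [totalDegree_C, zero_add]; exact hq)
  · obtain rfl : i = 0 := Subsingleton.elim _ _
    rw [Matrix.cons_val_zero, Matrix.cons_val_zero]
    exact (totalDegree_mul _ _).trans (by rw [totalDegree_C, zero_add]; exact hq)
  · rw [Fin.sum_univ_one, Matrix.cons_val_zero, Matrix.cons_val_zero]
    ring

/-- … and conversely every element of `M(q; 2)` (indeed of `M(q)`) is nonnegative on `K`, so for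
`deg p, deg q ≤ 2` with a Slater point **`p ∈ M(q; 2) ⟺ p ≥ 0 on {q ≥ 0}`**.
[cite: PolikTerlaky2007, Theorem 2.2 (p. 376)] [cite: Laurent2008, (6.2) (p. 89), (4.8) (p. 62)] -/
theorem mem_truncQuadraticModule_iff_nonneg {p q : MvPolynomial σ ℝ} (hp : p.totalDegree ≤ 2)
    (hq : q.totalDegree ≤ 2) (hS : ∃ xbar : σ → ℝ, 0 < eval xbar q) :
    p ∈ truncQuadraticModule ![q] 2 ↔ ∀ x : σ → ℝ, 0 ≤ eval x q → 0 ≤ eval x p := by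
  refine ⟨fun hmem x hx => ?_, mem_truncQuadraticModule_of_nonneg hp hq hS⟩
  have h0 : (0 : ℝ) ∈ sosFeasible ![q] p 2 := by
    rw [mem_sosFeasible_iff, map_zero, sub_zero]; exact hmem
  simpa using le_eval_of_mem_sosFeasible h0 (mem_semialgSet_single.2 hx)

/-! ## §3 Lasserre's program (6.2) at order one -/

/-- **`p − ρ ∈ M(q; 2) ⟺ ρ ≤ p` on `K = {q ≥ 0}`** for `deg p, deg q ≤ 2` with a Slater point:
the feasible `ρ` of the SOS program (6.2) at order one are exactly the lower bounds of `p` on `K`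
(soundness is the tree's `le_eval_of_mem_sosFeasible`, i.e. (4.8)).
[cite: PolikTerlaky2007, Theorem 2.2 (p. 376), §1 (1.1)–(1.3) (pp. 371–372)]
[cite: Laurent2008, (6.2) (p. 89), (4.8) (p. 62)] -/
theorem sub_C_mem_truncQuadraticModule_iff {p q : MvPolynomial σ ℝ} (hp : p.totalDegree ≤ 2)
    (hq : q.totalDegree ≤ 2) (hS : ∃ xbar : σ → ℝ, 0 < eval xbar q) (ρ : ℝ) :
    p - C ρ ∈ truncQuadraticModule ![q] 2 ↔ ∀ x : σ → ℝ, 0 ≤ eval x q → ρ ≤ eval x p := by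
  have hdeg : (p - C ρ).totalDegree ≤ 2 :=
    (totalDegree_sub _ _).trans (max_le hp (by rw [totalDegree_C]; exact Nat.zero_le _))
  rw [mem_truncQuadraticModule_iff_nonneg hdeg hq hS]
  refine forall_congr' fun x => imp_congr_right fun _ => ?_
  rw [map_sub, eval_C, sub_nonneg]

/-- Hence **the feasible set of (6.2) at order one is `{ρ | ρ ≤ p on K}`** (empty iff `p` is
unbounded below on `K`). [cite: Laurent2008, (6.2) (p. 89)]
[cite: PolikTerlaky2007, §1 (1.1)–(1.3) (pp. 371–372)] -/
theorem sosFeasible_eq {p q : MvPolynomial σ ℝ} (hp : p.totalDegree ≤ 2) (hq : q.totalDegree ≤ 2)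
    (hS : ∃ xbar : σ → ℝ, 0 < eval xbar q) :
    sosFeasible ![q] p 2 = {ρ | ∀ x : σ → ℝ, 0 ≤ eval x q → ρ ≤ eval x p} :=
  Set.ext fun ρ => sub_C_mem_truncQuadraticModule_iff hp hq hS ρ

/-- **`p^sos_1 = p^min`, attained**, when `p` attains its minimum on `K` at `x₀`: the first
Lasserre SOS bound of a one-constraint quadratic program is exact and the sup in (6.2) is a max.
[cite: Laurent2008, (6.2) (p. 89)] [cite: PolikTerlaky2007, Theorem 2.2 (p. 376), §1 (1.1)–(1.3)] -/
theorem sSup_sosFeasible_eq {p q : MvPolynomial σ ℝ} (hp : p.totalDegree ≤ 2)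
    (hq : q.totalDegree ≤ 2) (hS : ∃ xbar : σ → ℝ, 0 < eval xbar q) {x₀ : σ → ℝ}
    (hx₀ : 0 ≤ eval x₀ q) (hmin : ∀ x : σ → ℝ, 0 ≤ eval x q → eval x₀ p ≤ eval x p) :
    eval x₀ p ∈ sosFeasible ![q] p 2 ∧ sSup (sosFeasible ![q] p 2) = eval x₀ p := by
  rw [sosFeasible_eq hp hq hS]
  have hset : {ρ : ℝ | ∀ x : σ → ℝ, 0 ≤ eval x q → ρ ≤ eval x p} = Set.Iic (eval x₀ p) :=
    Set.ext fun ρ => ⟨fun h => h x₀ hx₀, fun h x hx => le_trans h (hmin x hx)⟩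
  rw [hset, csSup_Iic]
  exact ⟨Set.self_mem_Iic, rfl⟩

/-- **No gap: `p^sos_1 = p^mom_1 = p^min`** at an attained minimum — the moment bound (6.3) is
sandwiched by weak duality and the evaluation functional at `x₀` (tree: (4.8)).
[cite: Laurent2008, (4.8) (p. 62), (6.3) (p. 89)] [cite: PolikTerlaky2007, Theorem 2.2 (p. 376)] -/
theorem sInf_momentValues_eq {p q : MvPolynomial σ ℝ} (hp : p.totalDegree ≤ 2)
    (hq : q.totalDegree ≤ 2) (hS : ∃ xbar : σ → ℝ, 0 < eval xbar q) {x₀ : σ → ℝ}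
    (hx₀ : 0 ≤ eval x₀ q) (hmin : ∀ x : σ → ℝ, 0 ≤ eval x q → eval x₀ p ≤ eval x p) :
    sInf (momentValues ![q] p 2) = eval x₀ p := by
  obtain ⟨hfeas, hsup⟩ := sSup_sosFeasible_eq hp hq hS hx₀ hmin
  have hne : (sosFeasible ![q] p 2).Nonempty := ⟨_, hfeas⟩
  have hK : x₀ ∈ semialgSet ![q] := mem_semialgSet_single.2 hx₀
  have hne' : (momentValues ![q] p 2).Nonempty := ⟨_, eval_mem_momentValues p _ hK⟩
  refine le_antisymm (sInf_momentValues_le_eval hne hK) ?_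
  rw [← hsup]
  exact sSup_sosFeasible_le_sInf_momentValues hne hne'

/-! ## §4 A nonconvex instance: `x₁x₂` on the unit disk -/

/-- The indefinite objective `p = x₁x₂` (`x₁ = X 0`, `x₂ = X 1`). [cite: PolikTerlaky2007, §1
(1.1) (p. 371)] -/
def diskObj : MvPolynomial (Fin 2) ℝ := X 0 * X 1

/-- The unit-disk constraint `q = 1 − x₁² − x₂² ≥ 0`. [cite: PolikTerlaky2007, §1 (1.1) (p. 371)] -/
def diskCon : MvPolynomial (Fin 2) ℝ := 1 - X 0 ^ 2 - X 1 ^ 2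

/-- Values of the objective. [cite: PolikTerlaky2007, §1 (1.1) (p. 371)] -/
@[simp] theorem eval_diskObj (v : Fin 2 → ℝ) : eval v diskObj = v 0 * v 1 := by
  simp [diskObj]

/-- Values of the constraint. [cite: PolikTerlaky2007, §1 (1.1) (p. 371)] -/
@[simp] theorem eval_diskCon (v : Fin 2 → ℝ) : eval v diskCon = 1 - v 0 ^ 2 - v 1 ^ 2 := by
  simp [diskCon]

/-- **The degree-2 certificate** `x₁x₂ − (−½) = ½(x₁ + x₂)² + ½·(1 − x₁² − x₂²)`, identically.
[cite: Laurent2008, (6.2) (p. 89)] -/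
theorem disk_certificate :
    diskObj - C (-1 / 2 : ℝ) =
      C (1 / 2 : ℝ) * (X 0 + X 1) ^ 2 + C (1 / 2 : ℝ) * diskCon := by
  have hneg : (C (-1 / 2 : ℝ) : MvPolynomial (Fin 2) ℝ) = -C (1 / 2) := by
    rw [← map_neg]; norm_num
  have h : (C (1 / 2 : ℝ) : MvPolynomial (Fin 2) ℝ) * 2 = 1 := by
    rw [← map_ofNat C 2, ← map_mul, show (1 / 2 : ℝ) * 2 = 1 by norm_num, map_one]
  rw [hneg, diskObj, diskCon]
  linear_combination (-(X 0 * X 1 : MvPolynomial (Fin 2) ℝ)) * h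

/-- Hence `−½` is feasible for (6.2) at order one (`k = 2`): `x₁x₂ + ½ ∈ M(q; 2)` with
`s₀ = (x₁ + x₂)²/2`, `s₁ = ½`. [cite: Laurent2008, (6.2) (p. 89)] -/
theorem disk_min_mem_sosFeasible : (-1 / 2 : ℝ) ∈ sosFeasible ![diskCon] diskObj 2 := by
  rw [mem_sosFeasible_iff, disk_certificate]
  have hhalf : (C (1 / 2 : ℝ) : MvPolynomial (Fin 2) ℝ) =
      C (Real.sqrt (1 / 2)) * C (Real.sqrt (1 / 2)) := by
    rw [← map_mul, Real.mul_self_sqrt (by norm_num)]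
  refine ⟨C (1 / 2 : ℝ) * (X 0 + X 1) ^ 2, ![C (1 / 2 : ℝ)], ?_, fun i => ?_, ?_, fun i => ?_, ?_⟩
  · rw [hhalf, show C (Real.sqrt (1 / 2)) * C (Real.sqrt (1 / 2)) * (X 0 + X 1) ^ 2 =
        (C (Real.sqrt (1 / 2)) * (X 0 + X 1)) * (C (Real.sqrt (1 / 2)) * (X 0 + X 1 : MvPolynomial
          (Fin 2) ℝ)) by ring]
    exact IsSumSq.mul_self _
  · obtain rfl : i = 0 := Subsingleton.elim _ _
    rw [Matrix.cons_val_zero, hhalf]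
    exact IsSumSq.mul_self _
  · refine (totalDegree_mul _ _).trans ?_
    rw [totalDegree_C, zero_add]
    refine (totalDegree_pow _ _).trans ?_
    have h1 : (X 0 + X 1 : MvPolynomial (Fin 2) ℝ).totalDegree ≤ 1 :=
      (totalDegree_add _ _).trans (max_le (by rw [totalDegree_X]) (by rw [totalDegree_X]))
    omega
  · obtain rfl : i = 0 := Subsingleton.elim _ _
    rw [Matrix.cons_val_zero, Matrix.cons_val_zero]
    refine (totalDegree_mul _ _).trans ?_
    rw [totalDegree_C, zero_add, diskCon]
    refine (totalDegree_sub _ _).trans (max_le ((totalDegree_sub _ _).trans (max_le ?_ ?_)) ?_)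
    · rw [totalDegree_one]; omega
    · exact (totalDegree_pow _ _).trans (by rw [totalDegree_X])
    · exact (totalDegree_pow _ _).trans (by rw [totalDegree_X])
  · rw [Fin.sum_univ_one, Matrix.cons_val_zero, Matrix.cons_val_zero]

/-- The feasible point `(1/√2, −1/√2)` of the disk has objective value `−½`.
[cite: PolikTerlaky2007, §1 (1.1) (p. 371)] -/
theorem disk_eval_minimiser :
    0 ≤ eval ![Real.sqrt 2 / 2, -(Real.sqrt 2 / 2)] diskCon ∧
      eval ![Real.sqrt 2 / 2, -(Real.sqrt 2 / 2)] diskObj = -1 / 2 := by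
  have h2 : Real.sqrt 2 ^ 2 = 2 := Real.sq_sqrt (by norm_num)
  simp only [eval_diskCon, eval_diskObj, Matrix.cons_val_zero, Matrix.cons_val_one]
  constructor <;> nlinarith [h2]

/-- **Optimality**: no `ρ > −½` is feasible for (6.2), at ANY order `k` (soundness at the point
`(1/√2, −1/√2) ∈ K`). [cite: Laurent2008, (4.8) (p. 62)] -/
theorem disk_optimal (k : ℕ) {ρ : ℝ} (hρ : ρ ∈ sosFeasible ![diskCon] diskObj k) : ρ ≤ -1 / 2 := by
  obtain ⟨hK, hval⟩ := disk_eval_minimiser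
  rw [← hval]
  exact le_eval_of_mem_sosFeasible hρ (mem_semialgSet_single.2 hK)

/-- **`p^sos_1 = p^min = −½`** for `x₁x₂` on the unit disk: the first relaxation is exact for this
nonconvex one-constraint program (as `sosFeasible_eq` predicts).
[cite: Laurent2008, (6.2) (p. 89)] [cite: PolikTerlaky2007, Theorem 2.2 (p. 376)] -/
theorem disk_sSup : sSup (sosFeasible ![diskCon] diskObj 2) = -1 / 2 :=
  IsGreatest.csSup_eq ⟨disk_min_mem_sosFeasible, fun _ hρ => disk_optimal 2 hρ⟩

end

end Literature.Algebra.Polynomial.OneQuadraticConstraintSosExact
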